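import Mathlib
import Literature.Probability.LatticeModels.TriangularLattice
import Literature.Probability.LatticeModels.TriangularLatticeProofs

/-!
# Girth six: every non-empty even subgraph of the honeycomb lattice has at least six edges

Route `SAWMassiveIsingTilt` of `CriticalPhenomena/SAWScalingLimit`; line `registered` of the crux
`CriticalCurveContinuity` (stmt-CriticalPhenomena-7686), cycle 4, sub-goal S3'
`six_le_card_of_even_hexSubgraph`.

The bath of the loop-dressed hexagonal self-avoiding walk is the loop gas
`Zloop(H, S; y) = Σ_{even E ⊆ E(H[S])} y^{|E|}` over even subgraphs of pieces of the honeycomb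
lattice `hexGraph`; at the SAW corner `y = 0` it switches on only at order `y⁶`, because every
non-empty even edge set of the honeycomb lattice has at least six edges (the girth of the honeycomb
lattice is six). This file proves that statement in edge-set form
(`six_le_card_of_even_hexSubgraph`), by an elementary non-backtracking walk:

* `hexGirth_exists_next` — in an even edge set `E ⊆ hexGraph.edgeSet`, an edge `s(u, v) ∈ E`
  can always be continued by an edge `s(v, w) ∈ E` with `w ≠ u` (the `E`-degree of `v` is even
  and positive, hence at least two);
* `hexGirth_ne_of_adj₃`, `hexGirth_ne_of_adj₅` — the honeycomb lattice is bipartite (faces of the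
  same type are never adjacent, `not_hexGraph_adj_of_snd_eq_holds`), so walks of length `3` and `5`
  are never closed;
* `hexGirth_eq_or_eq_of_adj₄` — the honeycomb lattice has no `4`-cycles: two distinct faces have at
  most one common neighbour (coordinate arithmetic on the explicit neighbourhood of an up face,
  `hexGraph_adj_iff_of_snd_eq_zero_holds`);
* hence the first seven vertices `v₀, …, v₆` of a non-backtracking walk in `E` are pairwise
  distinct except possibly `v₀ = v₆`, and the six edges `s(vᵢ, vᵢ₊₁)`, `i < 6`, are distinct
  elements of `E`.
-/

noncomputable section

open Finset
open Literature.Probability Literature.Probability.LatticeModels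
  Literature.Probability.RandomPlanarGeometry
open scoped Classical

namespace Summit.CriticalPhenomena.SAWScalingLimit.Theorems.SAWMassiveIsingTilt

/-! ### Bipartiteness: odd walks are not closed -/

/-- In `Fin 2`, two consecutive inequalities compose to an equality. -/
theorem hexGirth_fin_two_eq_of_ne_of_ne : ∀ k l m : Fin 2, k ≠ l → l ≠ m → k = m := by
  decide

/-- A walk of length `3` in the honeycomb lattice is not closed (bipartiteness). -/
theorem hexGirth_ne_of_adj₃ {a b c d : HexVertex} (h₁ : hexGraph.Adj a b) (h₂ : hexGraph.Adj b c)
    (h₃ : hexGraph.Adj c d) : a ≠ d := by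
  intro had
  have hac : a.2 = c.2 := hexGirth_fin_two_eq_of_ne_of_ne _ _ _
    (fun h => not_hexGraph_adj_of_snd_eq_holds _ _ h h₁)
    (fun h => not_hexGraph_adj_of_snd_eq_holds _ _ h h₂)
  exact not_hexGraph_adj_of_snd_eq_holds c d (hac.symm.trans (congrArg Prod.snd had)) h₃

/-- A walk of length `5` in the honeycomb lattice is not closed (bipartiteness). -/
theorem hexGirth_ne_of_adj₅ {a b c d e f : HexVertex} (h₁ : hexGraph.Adj a b)
    (h₂ : hexGraph.Adj b c) (h₃ : hexGraph.Adj c d) (h₄ : hexGraph.Adj d e)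
    (h₅ : hexGraph.Adj e f) : a ≠ f := by
  intro haf
  have hac : a.2 = c.2 := hexGirth_fin_two_eq_of_ne_of_ne _ _ _
    (fun h => not_hexGraph_adj_of_snd_eq_holds _ _ h h₁)
    (fun h => not_hexGraph_adj_of_snd_eq_holds _ _ h h₂)
  have hce : c.2 = e.2 := hexGirth_fin_two_eq_of_ne_of_ne _ _ _
    (fun h => not_hexGraph_adj_of_snd_eq_holds _ _ h h₃)
    (fun h => not_hexGraph_adj_of_snd_eq_holds _ _ h h₄)
  exact not_hexGraph_adj_of_snd_eq_holds e f
    ((hac.trans hce).symm.trans (congrArg Prod.snd haf)) h₅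

/-! ### No `4`-cycles: two distinct faces have at most one common neighbour -/

/-- The down-neighbours of the up face of the cell `x`, in coordinates. -/
theorem hexGirth_coord_of_adj {x y : Site 2} (h : hexGraph.Adj (x, 0) (y, 1)) :
    (y 0 = x 0 ∧ y 1 = x 1) ∨ (y 0 = x 0 - 1 ∧ y 1 = x 1) ∨ (y 0 = x 0 ∧ y 1 = x 1 - 1) := by
  rcases (hexGraph_adj_iff_of_snd_eq_zero_holds x y).1 h with rfl | rfl | rfl <;> simp

/-- Two up faces `x ≠ z` have at most one common down-neighbour, and two down faces `y ≠ w` have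
at most one common up-neighbour: a closed walk `(x,0) → (y,1) → (z,0) → (w,1) → (x,0)` has
`x = z` or `y = w`. -/
theorem hexGirth_eq_or_eq_of_adj_coord {x y z w : Site 2} (h₁ : hexGraph.Adj (x, 0) (y, 1))
    (h₂ : hexGraph.Adj (z, 0) (y, 1)) (h₃ : hexGraph.Adj (z, 0) (w, 1))
    (h₄ : hexGraph.Adj (x, 0) (w, 1)) : x = z ∨ y = w := by
  have c₁ := hexGirth_coord_of_adj h₁
  have c₂ := hexGirth_coord_of_adj h₂
  have c₃ := hexGirth_coord_of_adj h₃
  have c₄ := hexGirth_coord_of_adj h₄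
  by_contra hcon
  simp only [not_or] at hcon
  obtain ⟨hxz, hyw⟩ := hcon
  rw [← Ne, Function.ne_iff, Fin.exists_fin_two] at hxz hyw
  omega

/-- **The honeycomb lattice has no `4`-cycles**: a closed walk `a → b → c → d → a` has `a = c` or
`b = d`. -/
theorem hexGirth_eq_or_eq_of_adj₄ {a b c d : HexVertex} (h₁ : hexGraph.Adj a b)
    (h₂ : hexGraph.Adj b c) (h₃ : hexGraph.Adj c d) (h₄ : hexGraph.Adj d a) : a = c ∨ b = d := by
  obtain ⟨x, k⟩ := a
  obtain ⟨y, l⟩ := b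
  obtain ⟨z, m⟩ := c
  obtain ⟨w, n⟩ := d
  have hkl : k ≠ l := fun h => not_hexGraph_adj_of_snd_eq_holds _ _ h h₁
  have hlm : l ≠ m := fun h => not_hexGraph_adj_of_snd_eq_holds _ _ h h₂
  have hmn : m ≠ n := fun h => not_hexGraph_adj_of_snd_eq_holds _ _ h h₃
  fin_cases k <;> fin_cases l <;> fin_cases m <;> fin_cases n <;>
    simp only [Fin.zero_eta, Fin.mk_one, ne_eq, not_true_eq_false] at hkl hlm hmn <;>
    simp only [Fin.zero_eta, Fin.mk_one, Prod.mk.injEq, and_true] at h₁ h₂ h₃ h₄ ⊢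
  · exact hexGirth_eq_or_eq_of_adj_coord h₁ h₂.symm h₃ h₄.symm
  · exact (hexGirth_eq_or_eq_of_adj_coord h₁.symm h₄ h₃.symm h₂).symm

/-! ### Continuing a walk inside an even edge set -/

/-- An edge of `E ⊆ hexGraph.edgeSet` joins adjacent faces. -/
theorem hexGirth_adj_of_mem {E : Finset (Sym2 HexVertex)} (hE : ∀ e ∈ E, e ∈ hexGraph.edgeSet)
    {u v : HexVertex} (huv : s(u, v) ∈ E) : hexGraph.Adj u v :=
  (SimpleGraph.mem_edgeSet hexGraph).1 (hE _ huv)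

/-- **Non-backtracking continuation.** In an even edge set `E ⊆ hexGraph.edgeSet`, every edge
`s(u, v) ∈ E` is followed by an edge `s(v, w) ∈ E` with `w ≠ u`: the `E`-degree of `v` is even and
positive, hence at least `2`. -/
theorem hexGirth_exists_next {E : Finset (Sym2 HexVertex)} (hE : ∀ e ∈ E, e ∈ hexGraph.edgeSet)
    (hev : ∀ u : HexVertex, Even (E.filter (fun e => u ∈ e)).card) {u v : HexVertex}
    (huv : s(u, v) ∈ E) : ∃ w : HexVertex, hexGraph.Adj v w ∧ w ≠ u ∧ s(v, w) ∈ E := by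
  have hF : s(u, v) ∈ E.filter (fun e => v ∈ e) := mem_filter.2 ⟨huv, Sym2.mem_mk_right u v⟩
  have hpos : 0 < (E.filter (fun e => v ∈ e)).card := card_pos.2 ⟨_, hF⟩
  have h1 : 1 < (E.filter (fun e => v ∈ e)).card := by
    obtain ⟨k, hk⟩ := hev v
    omega
  obtain ⟨e, heF, hne⟩ := exists_mem_ne h1 (s(u, v))
  obtain ⟨heE, hve⟩ := mem_filter.1 heF
  obtain ⟨w, rfl⟩ := Sym2.mem_iff_exists.1 hve
  refine ⟨w, hexGirth_adj_of_mem hE heE, ?_, heE⟩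
  rintro rfl
  exact hne Sym2.eq_swap

/-! ### Distinct edges -/

/-- Two unordered pairs differ if the first entry of one avoids both entries of the other. -/
theorem hexGirth_sym2_ne {a b c d : HexVertex} (hac : a ≠ c) (had : a ≠ d) : s(a, b) ≠ s(c, d) := by
  rw [Ne, Sym2.eq_iff]
  rintro (⟨h, -⟩ | ⟨h, -⟩)
  · exact hac h
  · exact had h

/-- Two unordered pairs differ if both entries of one avoid the first entry of the other. -/
theorem hexGirth_sym2_ne' {a b c d : HexVertex} (hac : a ≠ c) (hbc : b ≠ c) :
    s(a, b) ≠ s(c, d) := by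
  rw [Ne, Sym2.eq_iff]
  rintro (⟨h, -⟩ | ⟨-, h⟩)
  · exact hac h
  · exact hbc h

/-! ### Girth six -/

/-- **Girth six.** Every non-empty even edge set of the honeycomb lattice (every vertex has even
`E`-degree) has at least six edges: following a non-backtracking walk `v₀ v₁ ⋯ v₆` inside `E`
(`hexGirth_exists_next`), bipartiteness and the absence of `4`-cycles make the six edges
`s(vᵢ, vᵢ₊₁)` pairwise distinct. -/
theorem six_le_card_of_even_hexSubgraph : ∀ (E : Finset (Sym2 HexVertex)),
    (∀ e ∈ E, e ∈ hexGraph.edgeSet) → E.Nonempty →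
      (∀ u : HexVertex, Even (E.filter (fun e => u ∈ e)).card) → 6 ≤ E.card := by
  intro E hE hne hev
  obtain ⟨e₀, he₀⟩ := hne
  induction e₀ using Sym2.ind with
  | h v₀ v₁ =>
  have h01 : s(v₀, v₁) ∈ E := he₀
  have a01 : hexGraph.Adj v₀ v₁ := hexGirth_adj_of_mem hE h01
  -- the non-backtracking walk `v₀ v₁ v₂ v₃ v₄ v₅ v₆` inside `E`
  obtain ⟨v₂, a12, n20, h12⟩ := hexGirth_exists_next hE hev h01
  obtain ⟨v₃, a23, n31, h23⟩ := hexGirth_exists_next hE hev h12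
  obtain ⟨v₄, a34, n42, h34⟩ := hexGirth_exists_next hE hev h23
  obtain ⟨v₅, a45, n53, h45⟩ := hexGirth_exists_next hE hev h34
  obtain ⟨v₆, a56, n64, h56⟩ := hexGirth_exists_next hE hev h45
  -- distance 1
  have n01 : v₀ ≠ v₁ := a01.ne
  have n12 : v₁ ≠ v₂ := a12.ne
  have n23 : v₂ ≠ v₃ := a23.ne
  have n34 : v₃ ≠ v₄ := a34.ne
  have n45 : v₄ ≠ v₅ := a45.ne
  -- distance 2 (non-backtracking)
  have n02 : v₀ ≠ v₂ := n20.symm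
  have n13 : v₁ ≠ v₃ := n31.symm
  have n24 : v₂ ≠ v₄ := n42.symm
  have n35 : v₃ ≠ v₅ := n53.symm
  have n46 : v₄ ≠ v₆ := n64.symm
  -- distance 3 (bipartite)
  have n03 : v₀ ≠ v₃ := hexGirth_ne_of_adj₃ a01 a12 a23
  have n14 : v₁ ≠ v₄ := hexGirth_ne_of_adj₃ a12 a23 a34
  have n25 : v₂ ≠ v₅ := hexGirth_ne_of_adj₃ a23 a34 a45
  have n36 : v₃ ≠ v₆ := hexGirth_ne_of_adj₃ a34 a45 a56
  -- distance 4 (no `4`-cycles)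
  have n04 : v₀ ≠ v₄ := by
    rintro rfl
    rcases hexGirth_eq_or_eq_of_adj₄ a01 a12 a23 a34 with h | h
    · exact n02 h
    · exact n13 h
  have n15 : v₁ ≠ v₅ := by
    rintro rfl
    rcases hexGirth_eq_or_eq_of_adj₄ a12 a23 a34 a45 with h | h
    · exact n13 h
    · exact n24 h
  have n26 : v₂ ≠ v₆ := by
    rintro rfl
    rcases hexGirth_eq_or_eq_of_adj₄ a23 a34 a45 a56 with h | h
    · exact n24 h
    · exact n35 h
  -- distance 5 (bipartite)
  have n05 : v₀ ≠ v₅ := hexGirth_ne_of_adj₅ a01 a12 a23 a34 a45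
  have n16 : v₁ ≠ v₆ := hexGirth_ne_of_adj₅ a12 a23 a34 a45 a56
  -- the six edges are pairwise distinct
  have d01 := hexGirth_sym2_ne (b := v₁) (d := v₂) n01 n02
  have d02 := hexGirth_sym2_ne (b := v₁) (d := v₃) n02 n03
  have d03 := hexGirth_sym2_ne (b := v₁) (d := v₄) n03 n04
  have d04 := hexGirth_sym2_ne (b := v₁) (d := v₅) n04 n05
  have d05 := hexGirth_sym2_ne' (d := v₆) n05 n15
  have d12 := hexGirth_sym2_ne (b := v₂) (d := v₃) n12 n13
  have d13 := hexGirth_sym2_ne (b := v₂) (d := v₄) n13 n14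
  have d14 := hexGirth_sym2_ne (b := v₂) (d := v₅) n14 n15
  have d15 := hexGirth_sym2_ne (b := v₂) (d := v₆) n15 n16
  have d23 := hexGirth_sym2_ne (b := v₃) (d := v₄) n23 n24
  have d24 := hexGirth_sym2_ne (b := v₃) (d := v₅) n24 n25
  have d25 := hexGirth_sym2_ne (b := v₃) (d := v₆) n25 n26
  have d34 := hexGirth_sym2_ne (b := v₄) (d := v₅) n34 n35
  have d35 := hexGirth_sym2_ne (b := v₄) (d := v₆) n35 n36
  have d45 := hexGirth_sym2_ne (b := v₅) (d := v₆) n45 n46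
  -- six distinct edges of `E`
  set S : Finset (Sym2 HexVertex) :=
    {s(v₀, v₁), s(v₁, v₂), s(v₂, v₃), s(v₃, v₄), s(v₄, v₅), s(v₅, v₆)} with hS
  have hsub : S ⊆ E := by
    intro e he
    simp only [hS, mem_insert, mem_singleton] at he
    rcases he with rfl | rfl | rfl | rfl | rfl | rfl <;> assumption
  have hcard : S.card = 6 := by
    rw [hS, card_insert_of_notMem, card_insert_of_notMem, card_insert_of_notMem,
      card_insert_of_notMem, card_insert_of_notMem, card_singleton] <;>
      simp only [mem_insert, mem_singleton, not_or]
    · exact d45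
    · exact ⟨d34, d35⟩
    · exact ⟨d23, d24, d25⟩
    · exact ⟨d12, d13, d14, d15⟩
    · exact ⟨d01, d02, d03, d04, d05⟩
  calc 6 = S.card := hcard.symm
    _ ≤ E.card := card_le_card hsub

end Summit.CriticalPhenomena.SAWScalingLimit.Theorems.SAWMassiveIsingTilt

end
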